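import Summits.Ventures.PercRepro.RankLevelSetIndepDeficit

/-!
# PercRepro — THE SURPLUS OF THEOREM (a_p) AS A SUM OVER PAIRS (night-1, gen 9; dossier §18.6 / §19.4)

Theorem (a_p) (`indepSlack_contract_le`, d1830) says `τ′_{M／e}(p−1,q) ≤ τ′_M(p,q)`.  Its proof shows more: the
difference is an explicit nonnegative sum over pairs `(Z, X)` — `Z` an independent `u`-set avoiding `e`, `X ⊇ Z` a
dependent `p`-set — plus the pairs `(Z′, X)` with `Z′` an independent `q`-set of `M ／ {e}`.  This file records the
EXACT form:

* `deficit_sub_contract_eq` — `δ_u(M) − δ_{u−1}(M／e) = Σ_{Z ∈ I_u(M), e ∉ Z} dep_p(Z) / C(n−u, p−u)`;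
* **`indepSlack_sub_contract_eq`** — for `1 ≤ q`, `q + 2 ≤ p ≤ n`:
  `τ′_M(p,q) − τ′_{M／e}(p−1,q) = Σ_{q<u<p} Σ_{Z ∈ I_u(M), e ∉ Z} dep_p(Z) / C(n−u, p−u)
                                   + Σ_{Z′ ∈ I_q(M／e)} dep^{M／e}_{p−1}(Z′) / C(n−1−q, p−1−q)`.

These are the sums the tight-layer accounting (RankLevelSetTightContract and its paper sequel, §19.6) bounds from
below by counting dependent `p`-sets around the partitions of `U`.  Axioms: standard.
-/

open scoped Matroid

namespace PercRepro

open Set Finset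
open scoped Classical

variable {α : Type} (M : Matroid α) [M.Finite]

/-- The sum of `dep_p(Z)` over the independent `u`-sets `Z` avoiding `e`. -/
noncomputable def depSumAvoid (e : α) (u p : ℕ) : ℕ :=
  ∑ Z ∈ (indepSets M u).filter (fun Z => e ∉ Z), depCount M p Z

/-- The sum of `dep_p(Z)` over all independent `u`-sets splits by `e ∈ Z`. -/
lemma sum_depCount_split (e : α) (u p : ℕ) :
    ∑ Z ∈ indepSets M u, depCount M p Z =
      depSumAvoid M e u p + ∑ Z ∈ (indepSets M u).filter (fun Z => e ∈ Z), depCount M p Z := by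
  unfold depSumAvoid
  rw [add_comm, ← Finset.sum_filter_add_sum_filter_not (indepSets M u) (fun Z => e ∈ Z)]

/-- **The termwise surplus, exact**: for a non-loop `e` and `1 ≤ u ≤ p ≤ |E|`,
`δ_u(M) − δ_{u−1}(M／e) = Σ_{Z ∈ I_u(M), e ∉ Z} dep_p(Z) / C(n−u, p−u)`. -/
theorem deficit_sub_contract_eq {e : α} (he : M.IsNonloop e) {u p : ℕ} (hu : 1 ≤ u) (hup : u ≤ p)
    (hpn : p ≤ M.E.ncard) :
    (((indepSets M u).card : ℚ) -
        (M.E.ncard.choose u : ℚ) / (M.E.ncard.choose p : ℚ) * (indepSets M p).card) -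
      (((indepSets (M ／ {e}) (u - 1)).card : ℚ) -
        ((M.E.ncard - 1).choose (u - 1) : ℚ) / ((M.E.ncard - 1).choose (p - 1) : ℚ) *
          (indepSets (M ／ {e}) (p - 1)).card) =
      (depSumAvoid M e u p : ℚ) / ((M.E.ncard - u).choose (p - u) : ℚ) := by
  set n := M.E.ncard with hn
  have hn' : (M ／ {e}).E.ncard = n - 1 := by
    rw [Matroid.contract_ground, Set.ncard_sdiff_singleton_of_mem he.mem_ground]
  have hM := card_indepSets_mul_choose_add_sum_depCount M hup
  have hC := card_indepSets_mul_choose_add_sum_depCount (M ／ {e}) (u := u - 1) (p := p - 1) (by omega)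
  rw [hn'] at hC
  have hsame : (n - 1 - (u - 1)).choose (p - 1 - (u - 1)) = (n - u).choose (p - u) := by
    congr 1 <;> omega
  rw [hsame] at hC
  obtain ⟨v, rfl⟩ : ∃ v, u = v + 1 := ⟨u - 1, by omega⟩
  obtain ⟨r, rfl⟩ : ∃ r, p = r + 1 := ⟨p - 1, by omega⟩
  simp only [Nat.add_sub_cancel] at hC ⊢
  have hsplit := sum_depCount_split M e (v + 1) (r + 1)
  rw [sum_depCount_contract M he v r] at hsplit
  have hc : (0 : ℚ) < ((n - (v + 1)).choose (r + 1 - (v + 1)) : ℕ) := by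
    exact_mod_cast Nat.choose_pos (by omega)
  have hd1 : (0 : ℚ) < (n.choose (r + 1) : ℕ) := by exact_mod_cast Nat.choose_pos hpn
  have hd2 : (0 : ℚ) < ((n - 1).choose r : ℕ) := by exact_mod_cast Nat.choose_pos (by omega)
  have hA : ((indepSets M (v + 1)).card : ℚ) -
      (n.choose (v + 1) : ℚ) / (n.choose (r + 1) : ℚ) * (indepSets M (r + 1)).card =
      (∑ Z ∈ indepSets M (v + 1), depCount M (r + 1) Z : ℕ) /
        ((n - (v + 1)).choose (r + 1 - (v + 1)) : ℕ) := by
    refine deficit_arith (b := ((r + 1).choose (v + 1) : ℕ)) hc hd1 ?_ ?_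
    · rw [← hn] at hM
      exact_mod_cast hM
    · have := Nat.choose_mul (n := n) (k := r + 1) (s := v + 1) hup
      exact_mod_cast this.symm
  have hB : ((indepSets (M ／ {e}) v).card : ℚ) -
      ((n - 1).choose v : ℚ) / ((n - 1).choose r : ℚ) * (indepSets (M ／ {e}) r).card =
      (∑ Z' ∈ indepSets (M ／ {e}) v, depCount (M ／ {e}) r Z' : ℕ) /
        ((n - (v + 1)).choose (r + 1 - (v + 1)) : ℕ) := by
    refine deficit_arith (b := (r.choose v : ℕ)) hc hd2 ?_ ?_
    · exact_mod_cast hC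
    · have := Nat.choose_mul (n := n - 1) (k := r) (s := v) (by omega)
      have hsame2 : (n - 1 - v).choose (r - v) = (n - (v + 1)).choose (r + 1 - (v + 1)) := by
        congr 1 <;> omega
      rw [hsame2] at this
      exact_mod_cast this.symm
  rw [hA, hB, ← sub_div, hsplit]
  push_cast
  ring

/-- `Σ_{u ∈ Ioo q p} f (u − 1) = f q + Σ_{v ∈ Ioo q (p − 1)} f v` for `1 ≤ q`, `q + 2 ≤ p`. -/
lemma sum_Ioo_pred_eq (f : ℕ → ℚ) {p q : ℕ} (hq : 1 ≤ q) (hpq : q + 2 ≤ p) :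
    ∑ u ∈ Finset.Ioo q p, f (u - 1) = f q + ∑ v ∈ Finset.Ioo q (p - 1), f v := by
  have himg : Finset.Ioo q p = (Finset.Ioo (q - 1) (p - 1)).image (fun v => v + 1) := by
    ext u
    simp only [Finset.mem_Ioo, Finset.mem_image]
    constructor
    · intro hu
      exact ⟨u - 1, by omega, by omega⟩
    · rintro ⟨v, hv, rfl⟩
      omega
  rw [himg, Finset.sum_image (fun a _ b _ h => by omega)]
  simp only [Nat.add_sub_cancel]
  have hsplit : Finset.Ioo (q - 1) (p - 1) = insert q (Finset.Ioo q (p - 1)) := by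
    ext v
    simp only [Finset.mem_Ioo, Finset.mem_insert]
    omega
  rw [hsplit, Finset.sum_insert (by simp)]

/-- **Theorem (a_p) with its surplus made explicit**: for a non-loop `e`, `1 ≤ q`, `q + 2 ≤ p ≤ |E|`,
`τ′_M(p,q) − τ′_{M／e}(p−1,q) = Σ_{q<u<p} Σ_{Z ∈ I_u(M), e ∉ Z} dep_p(Z) / C(n−u,p−u) +
Σ_{Z′ ∈ I_q(M／e)} dep^{M／e}_{p−1}(Z′) / C(n−1−q, p−1−q)`. -/
theorem indepSlack_sub_contract_eq {e : α} (he : M.IsNonloop e) {p q : ℕ} (hq : 1 ≤ q)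
    (hpq : q + 2 ≤ p) (hpn : p ≤ M.E.ncard) :
    indepSlack M p q - indepSlack (M ／ {e}) (p - 1) q =
      ∑ u ∈ Finset.Ioo q p, (depSumAvoid M e u p : ℚ) / ((M.E.ncard - u).choose (p - u) : ℚ) +
        (∑ Z' ∈ indepSets (M ／ {e}) q, depCount (M ／ {e}) (p - 1) Z' : ℕ) /
          ((M.E.ncard - 1 - q).choose (p - 1 - q) : ℚ) := by
  set n := M.E.ncard with hn
  have hn' : (M ／ {e}).E.ncard = n - 1 := by
    rw [Matroid.contract_ground, Set.ncard_sdiff_singleton_of_mem he.mem_ground]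
  -- the deficit of `M ／ {e}` at level `v` (top `p − 1`)
  set g : ℕ → ℚ := fun v => ((indepSets (M ／ {e}) v).card : ℚ) -
    ((n - 1).choose v : ℚ) / ((n - 1).choose (p - 1) : ℚ) * (indepSets (M ／ {e}) (p - 1)).card with hg
  have hslackC : indepSlack (M ／ {e}) (p - 1) q = ∑ v ∈ Finset.Ioo q (p - 1), g v := by
    unfold indepSlack
    rw [hn']
  have hslackM : indepSlack M p q = ∑ u ∈ Finset.Ioo q p, (((indepSets M u).card : ℚ) -
      (n.choose u : ℚ) / (n.choose p : ℚ) * (indepSets M p).card) := by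
    unfold indepSlack
    rfl
  -- termwise surplus
  have hterm : ∀ u ∈ Finset.Ioo q p, (((indepSets M u).card : ℚ) -
      (n.choose u : ℚ) / (n.choose p : ℚ) * (indepSets M p).card) - g (u - 1) =
      (depSumAvoid M e u p : ℚ) / ((n - u).choose (p - u) : ℚ) := by
    intro u hu
    rw [Finset.mem_Ioo] at hu
    exact deficit_sub_contract_eq M he (by omega) (by omega) hpn
  -- `δ_q(M／e)` by Lemma 1 for the contraction
  have hgq : g q = (∑ Z' ∈ indepSets (M ／ {e}) q, depCount (M ／ {e}) (p - 1) Z' : ℕ) /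
      ((n - 1 - q).choose (p - 1 - q) : ℚ) := by
    have hC := card_indepSets_mul_choose_add_sum_depCount (M ／ {e}) (u := q) (p := p - 1) (by omega)
    rw [hn'] at hC
    have hc : (0 : ℚ) < ((n - 1 - q).choose (p - 1 - q) : ℕ) := by
      exact_mod_cast Nat.choose_pos (by omega)
    have hd : (0 : ℚ) < ((n - 1).choose (p - 1) : ℕ) := by exact_mod_cast Nat.choose_pos (by omega)
    refine deficit_arith (b := ((p - 1).choose q : ℕ)) hc hd ?_ ?_
    · exact_mod_cast hC
    · have := Nat.choose_mul (n := n - 1) (k := p - 1) (s := q) (by omega)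
      exact_mod_cast this.symm
  have hA : ∑ u ∈ Finset.Ioo q p, (((indepSets M u).card : ℚ) -
      (n.choose u : ℚ) / (n.choose p : ℚ) * (indepSets M p).card) =
      ∑ u ∈ Finset.Ioo q p, (g (u - 1) + (depSumAvoid M e u p : ℚ) / ((n - u).choose (p - u) : ℚ)) := by
    refine Finset.sum_congr rfl (fun u hu => ?_)
    have := hterm u hu
    linarith
  have hsum := sum_Ioo_pred_eq g hq hpq
  rw [hslackM, hslackC, ← hgq, hA, Finset.sum_add_distrib, hsum]
  ring

end PercRepro
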